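import Literature.NumberTheory.LFunctions.Zhang2022.Section8LFunctionFloor
import Literature.NumberTheory.LFunctions.Zhang2022.SkeletonPartThree
import HarnessLib

/-!
# Zhang (2022) §8: the packaged `L(s,χ)`-floor on the moved contour (Lemma 5.5 instantiation)

Trunk T-ANT (NumberTheory/LFunctions). DAG node context: `Z22:Lem8.4.pf` [Zhang2022LandauSiegel,
§8 p. 46, tex L2405] and `Z22:Lem10.2.pf` [p. 56, tex L2825–2830]. Companion to
`Section8LFunctionFloor.lean` (p412903): that file proves the `1/L`-size inference of the printed
contour moves from abstract zero-free data; THIS file instantiates it with the manuscript's own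
Lemma 5.5 (tree: `Skeleton.lemma55_holds`, unconditional via `deuring_heilbronn_holds`) and
packages the result in the campaign's `ForAllLarge`/`(A)` frame with `ε = 1/𝓛`:

* `norm_LFunction_ge_on_contour_ball` — AWAY heights `3/𝓛 ≤ |t| ≤ D`: the uniform floor
  `c ≤ ‖L(z,χ)‖·𝓛²⁵` on `closedBall (1 + 1/𝓛 + it) (12/(5𝓛))` (covers the moved vertical
  segment AND the horizontal connectors at `|t| = D` of the Lemma 8.2-pattern contour).
* `norm_LFunction_ge_on_shifted_line` — ALL heights `|t| ≤ D`: the same floor at the point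
  `1 − 1/𝓛 + it` of the moved segment (near the real axis the exceptional zero `ρ̃` is
  `O(𝓛⁻²⁰²²)`-close to `1`, hence `≥ 1/(2𝓛)` away from the segment, and the `dslope`-factored
  NEAR floor of p412903 applies).

The floors are stated inverse-free (`c ≤ ‖L‖·𝓛²⁵`, an absolute explicit `c`); `25` is a
convenient common exponent (`𝓛⁻¹⁷` actually holds away from the axis). Consumers: the
dischargers of `Z22:Lem8.4.pf` (Lemma 8.4's contour, whose integrand carries `1/L(1+s,χ)`) and
of `Z22:(10.8)–(10.11)` (the `𝔳₂ⱼ` contours, same shape). Status of the source: an unrefereed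
manuscript under adjudication; nothing here asserts anything about Theorems 1–2 or Landau–Siegel
zeros — these are floors for `L(·,χ)` under the hypothesis `(A)`, i.e. steps of the printed
proof, kernel-checked.
-/

noncomputable section

open Complex Metric Set Real

namespace Literature.NumberTheory.LFunctions.Zhang2022.Section8Floor

open Literature.NumberTheory.LFunctions.Zhang2022.Skeleton

/-- The working threshold: for any `M` there is a `D₁` with `M ≤ 𝓛 = log D` for all `D ≥ D₁`.
[cite: Zhang2022LandauSiegel, §2 p. 4 ("sufficiently large D")] -/
theorem exists_threshold (M : ℝ) : ∃ D₁ : ℕ, ∀ D : ℕ, D₁ ≤ D → M ≤ ell D := by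
  refine ⟨⌈Real.exp M⌉₊ + 1, fun D hD => ?_⟩
  have h1 : Real.exp M ≤ D := by
    have h2 : (⌈Real.exp M⌉₊ : ℝ) + 1 ≤ D := by exact_mod_cast hD
    have h3 := Nat.le_ceil (Real.exp M)
    linarith
  have hD0 : (0 : ℝ) < D := lt_of_lt_of_le (Real.exp_pos M) h1
  rw [ell]
  exact (Real.le_log_iff_exp_le hD0).mpr h1

/-- `exp 6 ≤ 500` (used to absorb the `(q(|t|+3))^{2/𝓛}` factor). [folklore] -/
private theorem exp_six_le : Real.exp 6 ≤ 500 := by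
  have h6 : Real.exp 6 = (Real.exp 1) ^ 6 := by
    rw [← Real.exp_nat_mul]; norm_num
  have h1 : Real.exp 1 ≤ 2.7182818286 := Real.exp_one_lt_d9.le
  calc Real.exp 6 = (Real.exp 1) ^ 6 := h6
    _ ≤ 2.7182818286 ^ 6 := pow_le_pow_left₀ (Real.exp_pos 1).le h1 6
    _ ≤ 500 := by norm_num

/-- `log 4 ≤ 1.4` (used in `log(|t|+3) ≤ 𝓛 + 1.4` for `|t| ≤ D`). [folklore] -/
private theorem log_four_le : Real.log 4 ≤ 1.4 := by
  have h : Real.log 4 = 2 * Real.log 2 := by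
    rw [show (4 : ℝ) = 2 ^ 2 by norm_num, Real.log_pow]
    push_cast; ring
  rw [h]
  nlinarith [Real.log_two_lt_d9]

set_option maxHeartbeats 400000 in
/-- **The away-heights floor on the contour ball** — the Lemma 5.5 instantiation of
`norm_LFunction_ge_of_zerofree`: under `(A)`, for `3/𝓛 ≤ |t| ≤ D`, every `z` in
`closedBall (1 + 1/𝓛 + it) (12/(5𝓛))` has `c ≤ ‖L(z,χ)‖·𝓛²⁵`, with the absolute
`c = (2⁹·6¹³·2000⁸·40000¹²·2)⁻¹`. The zero-freeness is free: by Lemma 5.5 the only zero of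
`L(·,χ)` in `σ > 1 − 2/𝓛`, `|im| < 2D` is the REAL `ρ̃`, and the ball stays `≥ 3/𝓛` above it.
[cite: Zhang2022LandauSiegel, §8 Lemma 8.4 proof (tex L2405), §10 Lemma 10.2 proof (tex L2830),
with §5 Lemma 5.5] -/
theorem norm_LFunction_ge_on_contour_ball :
    ∃ c : ℝ, 0 < c ∧ ForAllLarge fun D _ χ => AssumptionA D χ →
      ∀ t : ℝ, 3 * (ell D)⁻¹ ≤ |t| → |t| ≤ D →
        ∀ z ∈ closedBall (1 + (ell D)⁻¹ + t * I : ℂ) (12 / 5 * (ell D)⁻¹),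
          c ≤ ‖χ.LFunction z‖ * ell D ^ 25 := by
  obtain ⟨C55, hFAL55⟩ := lemma55_holds
  obtain ⟨D55, h55⟩ := hFAL55
  obtain ⟨D₁, hD₁⟩ := exists_threshold 8
  refine ⟨(2 ^ 9 * 6 ^ 13 * 2000 ^ 8 * 40000 ^ 12 * 2 : ℝ)⁻¹, by positivity,
    max D55 D₁, fun D _ χ hD hq hp hA t h3t htD z hz => ?_⟩
  -- thresholds
  have hL8 : (8 : ℝ) ≤ ell D := hD₁ D (le_trans (le_max_right _ _) hD)
  have hL0 : (0 : ℝ) < ell D := by linarith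
  set ε : ℝ := (ell D)⁻¹ with hε
  have hε0 : 0 < ε := by positivity
  have hεL : ε * ell D = 1 := inv_mul_cancel₀ hL0.ne'
  have hε8 : ε ≤ 1 / 8 := by
    rw [hε, show (1 : ℝ) / 8 = 8⁻¹ by norm_num]
    exact inv_anti₀ (by norm_num) hL8
  have hD3 : 3 ≤ D := by
    rcases Nat.lt_or_ge D 3 with h | h
    · exfalso
      have hD1 : 1 ≤ D := NeZero.one_le
      have hD2 : (D : ℝ) ≤ 2 := by exact_mod_cast Nat.lt_succ_iff.mp h
      have hlog : ell D ≤ Real.log 2 := by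
        rw [ell]
        exact Real.log_le_log (by exact_mod_cast hD1) hD2
      nlinarith [Real.log_two_lt_d9]
    · exact h
  have hχ1 : χ ≠ 1 := ne_one_of_isPrimitive_of_three_le hp hD3
  -- Lemma 5.5 data
  obtain ⟨ρt, hρ0, hρd, hρnn, hρloc, huniq⟩ :=
    h55 D χ (le_trans (le_max_left _ _) hD) hq hp hA
  -- zero-freeness on the `3ε`-ball: the only candidate is the real `ρ̃`, excluded by `|t| ≥ 3ε`
  have hzf : ∀ w ∈ ball (1 + ε + t * I : ℂ) (3 * ε), χ.LFunction w ≠ 0 := by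
    intro w hw h0
    have hwball : ‖w - (1 + ε + t * I : ℂ)‖ < 3 * ε := by
      simpa [mem_ball, dist_eq_norm] using hw
    have hre_lt : |w.re - (1 + ε)| < 3 * ε := by
      have h := abs_re_le_norm (w - (1 + ε + t * I : ℂ))
      have he : (w - (1 + ε + t * I : ℂ)).re = w.re - (1 + ε) := by simp
      rw [he] at h
      exact lt_of_le_of_lt h hwball
    have him_lt : |w.im - t| < 3 * ε := by
      have h := abs_im_le_norm (w - (1 + ε + t * I : ℂ))
      have he : (w - (1 + ε + t * I : ℂ)).im = w.im - t := by simp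
      rw [he] at h
      exact lt_of_le_of_lt h hwball
    have hwre' : 1 - 2 / ell D < w.re := by
      have h1 := (abs_lt.mp hre_lt).1
      have h2 : (2 : ℝ) / ell D = 2 * ε := by rw [hε]; ring
      rw [h2]; linarith
    have hwim : |w.im| < 2 * D := by
      have hD1 : (1 : ℝ) ≤ D := by exact_mod_cast le_trans (by norm_num) hD3
      have h3 : 3 * ε ≤ 3 / 8 := by linarith
      calc |w.im| = |t + (w.im - t)| := by ring_nf
        _ ≤ |t| + |w.im - t| := abs_add_le _ _
        _ < D + 3 * ε := by linarith [him_lt, htD]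
        _ ≤ 2 * D := by linarith
    have hwρ : w = (ρt : ℂ) := huniq w h0 hwre' hwim
    -- `im ρ̃ = 0` forces `|t| < 3ε`, contradiction
    rw [hwρ] at him_lt
    simp only [Complex.ofReal_im, zero_sub, abs_neg] at him_lt
    linarith
  -- the explicit upper bound `B` and `B ≤ 2000𝓛`
  set B : ℝ := ((D : ℝ) * (|t| + 3)) ^ (2 * ε) * (4 + Real.log D + Real.log (|t| + 3)) with hB
  have hDR : (1 : ℝ) ≤ (D : ℝ) := by exact_mod_cast le_trans (by norm_num) hD3
  have hlogD : Real.log D = ell D := rfl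
  have hlogt : Real.log (|t| + 3) ≤ ell D + 1.4 := by
    have h1 : |t| + 3 ≤ 4 * D := by nlinarith [htD, abs_nonneg t]
    calc Real.log (|t| + 3) ≤ Real.log (4 * D) :=
          Real.log_le_log (by positivity) h1
      _ = Real.log 4 + Real.log D := Real.log_mul (by norm_num) (by positivity)
      _ ≤ ell D + 1.4 := by rw [hlogD]; linarith [log_four_le]
  have hlogt0 : 0 ≤ Real.log (|t| + 3) :=
    Real.log_nonneg (by linarith [abs_nonneg t])
  have hlogD0 : 0 ≤ Real.log D := Real.log_nonneg hDR
  have hbase : (1 : ℝ) ≤ (D : ℝ) * (|t| + 3) := by nlinarith [abs_nonneg t]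
  have hB4 : 4 ≤ B := by
    rw [hB]
    have h1 : (1 : ℝ) ≤ ((D : ℝ) * (|t| + 3)) ^ (2 * ε) := by
      calc (1 : ℝ) = ((D : ℝ) * (|t| + 3)) ^ (0 : ℝ) := (Real.rpow_zero _).symm
        _ ≤ ((D : ℝ) * (|t| + 3)) ^ (2 * ε) :=
            Real.rpow_le_rpow_of_exponent_le hbase (by positivity)
    nlinarith [hlogt0, hlogD0]
  have hB2000 : B ≤ 2000 * ell D := by
    rw [hB]
    have h1 : ((D : ℝ) * (|t| + 3)) ^ (2 * ε) ≤ 500 := by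
      refine le_trans ?_ exp_six_le
      rw [Real.rpow_def_of_pos (by positivity)]
      apply Real.exp_le_exp.mpr
      have hlogbase : Real.log ((D : ℝ) * (|t| + 3)) ≤ 3 * ell D := by
        rw [Real.log_mul (by positivity) (by positivity), hlogD]
        linarith [hlogt, hL8]
      calc Real.log ((D : ℝ) * (|t| + 3)) * (2 * ε) ≤ 3 * ell D * (2 * ε) := by
            apply mul_le_mul_of_nonneg_right hlogbase (by positivity)
        _ = 6 * (ε * ell D) := by ring
        _ = 6 := by rw [hεL]; ring
    have h2 : 4 + Real.log D + Real.log (|t| + 3) ≤ 4 * ell D := by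
      rw [hlogD]; linarith [hlogt, hL8]
    have hpos2 : (0 : ℝ) ≤ 4 + Real.log D + Real.log (|t| + 3) := by linarith
    calc ((D : ℝ) * (|t| + 3)) ^ (2 * ε) * (4 + Real.log D + Real.log (|t| + 3))
        ≤ 500 * (4 * ell D) := mul_le_mul h1 h2 hpos2 (by norm_num)
      _ = 2000 * ell D := by ring
  -- the `B`-hypothesis of the floor theorem and the floor itself
  have hBub : ∀ w ∈ ball (1 + ε + t * I : ℂ) (3 * ε), ‖χ.LFunction w‖ ≤ B :=
    fun w hw => norm_LFunction_le_on_ball χ hχ1 hε0 hε8 hw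
  have hfloor := norm_LFunction_ge_of_zerofree χ hχ1 hε0 hε8 hzf hB4 hBub hz
  -- the centre-floor `m = ε/(1+ε)` satisfies `1 ≤ m·(2𝓛)`
  set m : ℝ := ε / (1 + ε) with hm
  have hm0 : 0 < m := by rw [hm]; positivity
  have hm2 : 1 ≤ m * (2 * ell D) := by
    have h1 : m * (2 * ell D) = 2 * (ε * ell D) / (1 + ε) := by rw [hm]; ring
    rw [h1, hεL, le_div_iff₀ (by positivity)]
    linarith
  have hLz0 : 0 < ‖χ.LFunction z‖ := by
    have hzball : z ∈ ball (1 + ε + t * I : ℂ) (3 * ε) := by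
      have := mem_closedBall.mp hz
      rw [mem_ball]
      calc dist z (1 + ε + t * I : ℂ) ≤ 12 / 5 * ε := this
        _ < 3 * ε := by linarith
    exact norm_pos_iff.mpr (hzf z hzball)
  have hB0 : (0 : ℝ) < B := by linarith
  have hL1 : (1 : ℝ) ≤ ell D := by linarith
  -- conclusion: `c·B⁸ ≤ (‖L z‖·𝓛²⁵)·B⁸`, cancel `B⁸`
  refine le_of_mul_le_mul_right ?_ (pow_pos hB0 8)
  have key1 : m ^ 9 * ell D ^ 25 ≤ (‖χ.LFunction z‖ * ell D ^ 25) * B ^ 8 := by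
    calc m ^ 9 * ell D ^ 25 ≤ (‖χ.LFunction z‖ * B ^ 8) * ell D ^ 25 := by
          exact mul_le_mul_of_nonneg_right hfloor (by positivity)
      _ = (‖χ.LFunction z‖ * ell D ^ 25) * B ^ 8 := by ring
  refine le_trans ?_ key1
  -- `c·B⁸ ≤ m⁹·𝓛²⁵`: via `B ≤ 2000𝓛`, `1 ≤ m(2𝓛)`, `1 ≤ 𝓛⁸`
  have hstep1 : (2 ^ 9 * 6 ^ 13 * 2000 ^ 8 * 40000 ^ 12 * 2 : ℝ)⁻¹ * B ^ 8 ≤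
      (2 ^ 9 * 6 ^ 13 * 2000 ^ 8 * 40000 ^ 12 * 2 : ℝ)⁻¹ * (2000 * ell D) ^ 8 := by
    apply mul_le_mul_of_nonneg_left (pow_le_pow_left₀ (by linarith) hB2000 8) (by positivity)
  refine le_trans hstep1 ?_
  -- final numeral step: `K⁻¹·(2000𝓛)⁸ ≤ m⁹𝓛²⁵` since `(m·2𝓛)⁹ ≥ 1` and `𝓛⁸ ≥ 1`
  have hmL : 1 ≤ (m * (2 * ell D)) ^ 9 := one_le_pow₀ hm2
  have hL8p : (1 : ℝ) ≤ ell D ^ 8 := one_le_pow₀ hL1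
  have hexpand : (m * (2 * ell D)) ^ 9 = m ^ 9 * (2 ^ 9 * ell D ^ 9) := by ring
  rw [hexpand] at hmL
  -- final numeral step: `K⁻¹·(2000𝓛)⁸ ≤ m⁹𝓛²⁵` since `(m·2𝓛)⁹·𝓛⁸ ≥ 1` and `K ≥ 2⁹·2000⁸`
  have hA1 : (1 : ℝ) ≤ m ^ 9 * (2 ^ 9 * ell D ^ 9) * ell D ^ 8 :=
    le_trans hmL (le_mul_of_one_le_right (by positivity) hL8p)
  have hmain : (2000 : ℝ) ^ 8 * ell D ^ 8 ≤ 2 ^ 9 * 6 ^ 13 * 2000 ^ 8 * 40000 ^ 12 * 2 *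
      (m ^ 9 * ell D ^ 25) := by
    calc (2000 : ℝ) ^ 8 * ell D ^ 8
        ≤ (2000 ^ 8 * ell D ^ 8) * (m ^ 9 * (2 ^ 9 * ell D ^ 9) * ell D ^ 8) :=
          le_mul_of_one_le_right (by positivity) hA1
      _ = 2 ^ 9 * 2000 ^ 8 * (m ^ 9 * ell D ^ 25) := by ring
      _ ≤ 2 ^ 9 * 6 ^ 13 * 2000 ^ 8 * 40000 ^ 12 * 2 * (m ^ 9 * ell D ^ 25) := by
          apply mul_le_mul_of_nonneg_right ?_ (by positivity)
          nlinarith [one_le_pow₀ (show (1:ℝ) ≤ 6 by norm_num) (n := 13),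
            one_le_pow₀ (show (1:ℝ) ≤ 40000 by norm_num) (n := 12)]
  rw [mul_pow, inv_mul_le_iff₀ (by positivity)]
  exact hmain

/-- **The all-heights floor on the moved segment** — the Lemma 5.5 instantiation of both floors
of p412903: under `(A)`, for every `|t| ≤ D`, the point `1 − 1/𝓛 + it` of the moved contour
segment satisfies `c ≤ ‖L(1 − 1/𝓛 + it, χ)‖·𝓛²⁵` for an absolute `c > 0`. Away from the real
axis (`|t| ≥ 3/𝓛`) this is `norm_LFunction_ge_on_contour_ball`; near it, the exceptional zero
`ρ̃` is `O(𝓛⁻²⁰²²)`-close to `1`, hence `≥ 1/(2𝓛)` from the segment, and the `dslope`-factored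
NEAR floor applies. [cite: Zhang2022LandauSiegel, §8 Lemma 8.4 proof (tex L2405), §10 Lemma 10.2
proof (tex L2830), with §5 Lemma 5.5] -/
theorem norm_LFunction_ge_on_shifted_line :
    ∃ c : ℝ, 0 < c ∧ ForAllLarge fun D _ χ => AssumptionA D χ →
      ∀ t : ℝ, |t| ≤ D →
        c ≤ ‖χ.LFunction (1 - (ell D)⁻¹ + t * I : ℂ)‖ * ell D ^ 25 := by
  obtain ⟨c₁, hc₁, hFAL₁⟩ := norm_LFunction_ge_on_contour_ball
  obtain ⟨Dball, hball⟩ := hFAL₁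
  obtain ⟨C55, hFAL55⟩ := lemma55_holds
  obtain ⟨D55, h55⟩ := hFAL55
  obtain ⟨D₁, hD₁⟩ := exists_threshold (max 8 (2 * C55))
  refine ⟨min c₁ (2 ^ 9 * 6 ^ 13 * 2000 ^ 8 * 40000 ^ 12 * 2 : ℝ)⁻¹,
    lt_min hc₁ (by positivity), max Dball (max D55 D₁), fun D _ χ hD hq hp hA t htD => ?_⟩
  -- thresholds
  have hL8 : (8 : ℝ) ≤ ell D := le_trans (le_max_left _ _)
    (hD₁ D (le_trans (le_trans (le_max_right _ _) (le_max_right _ _)) hD))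
  have hLC : 2 * C55 ≤ ell D := le_trans (le_max_right _ _)
    (hD₁ D (le_trans (le_trans (le_max_right _ _) (le_max_right _ _)) hD))
  have hL0 : (0 : ℝ) < ell D := by linarith
  set ε : ℝ := (ell D)⁻¹ with hε
  have hε0 : 0 < ε := by positivity
  have hεL : ε * ell D = 1 := inv_mul_cancel₀ hL0.ne'
  have hε8 : ε ≤ 1 / 8 := by
    rw [hε, show (1 : ℝ) / 8 = 8⁻¹ by norm_num]
    exact inv_anti₀ (by norm_num) hL8
  rcases le_or_gt (3 * ε) |t| with hcase | hcase
  · -- AWAY: the ball theorem at the line point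
    have hz : (1 - ε + t * I : ℂ) ∈ closedBall (1 + ε + t * I : ℂ) (12 / 5 * ε) := by
      rw [mem_closedBall, dist_eq_norm]
      have he : (1 - ε + t * I : ℂ) - (1 + ε + t * I : ℂ) = ((-(2 * ε) : ℝ) : ℂ) := by
        push_cast; ring
      rw [he, Complex.norm_real, Real.norm_eq_abs, abs_neg, abs_of_pos (by positivity)]
      linarith
    have h := hball D χ (le_trans (le_max_left _ _) hD) hq hp hA t
      (by rw [← hε] at *; exact hcase) htD _ hz
    calc min c₁ (2 ^ 9 * 6 ^ 13 * 2000 ^ 8 * 40000 ^ 12 * 2 : ℝ)⁻¹ ≤ c₁ := min_le_left _ _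
      _ ≤ _ := h
  · -- NEAR: the dslope floor
    have hD3 : 3 ≤ D := by
      rcases Nat.lt_or_ge D 3 with h | h
      · exfalso
        have hD1 : 1 ≤ D := NeZero.one_le
        have hD2 : (D : ℝ) ≤ 2 := by exact_mod_cast Nat.lt_succ_iff.mp h
        have hlog : ell D ≤ Real.log 2 := by
          rw [ell]
          exact Real.log_le_log (by exact_mod_cast hD1) hD2
        nlinarith [Real.log_two_lt_d9]
      · exact h
    have hχ1 : χ ≠ 1 := ne_one_of_isPrimitive_of_three_le hp hD3
    obtain ⟨ρt, hρ0, hρd, hρnn, hρloc, huniq⟩ :=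
      h55 D χ (le_trans (le_max_left _ _) (le_trans (le_max_right _ _) hD)) hq hp hA
    -- `1 − ρ̃ ≤ ε/2` from `C₅₅𝓛⁻²⁰²²` and `2C₅₅ ≤ 𝓛 ≤ 𝓛²⁰²¹`
    have hρhalf : 1 - ρt ≤ ε / 2 := by
      have h2021 : ell D ≤ ell D ^ 2021 := by
        calc ell D = ell D ^ 1 := (pow_one _).symm
          _ ≤ ell D ^ 2021 := pow_le_pow_right₀ (by linarith) (by norm_num)
      have hC : C55 * (ell D ^ 2022)⁻¹ ≤ ε / 2 := by
        rw [hε, div_eq_mul_inv]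
        have h1 : C55 * (ell D ^ 2022)⁻¹ * (2 * ell D ^ 2022) ≤
            (ell D)⁻¹ * 2⁻¹ * (2 * ell D ^ 2022) := by
          have hL2022 : (0 : ℝ) < ell D ^ 2022 := pow_pos hL0 2022
          have lhs_eq : C55 * (ell D ^ 2022)⁻¹ * (2 * ell D ^ 2022) = 2 * C55 := by
            field_simp
          have rhs_eq : (ell D)⁻¹ * 2⁻¹ * (2 * ell D ^ 2022) = ell D ^ 2021 := by
            have : ell D ^ 2022 = ell D * ell D ^ 2021 := by ring
            rw [this]
            field_simp
          rw [lhs_eq, rhs_eq]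
          linarith [hLC, h2021]
        have hpos : (0 : ℝ) < 2 * ell D ^ 2022 := by positivity
        exact le_of_mul_le_mul_right h1 hpos
      linarith [hρloc, hC]
    have hρ1 : 1 - ε / 2 ≤ ρt := by linarith
    have hρle : ρt ≤ 1 := by linarith
    -- ball-local uniqueness from Lemma 5.5
    have huniq' : ∀ w ∈ ball (1 + ε + t * I : ℂ) (3 * ε), χ.LFunction w = 0 → w = (ρt : ℂ) := by
      intro w hw h0
      have hwball : ‖w - (1 + ε + t * I : ℂ)‖ < 3 * ε := by
        simpa [mem_ball, dist_eq_norm] using hw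
      have hre_lt : |w.re - (1 + ε)| < 3 * ε := by
        have h := abs_re_le_norm (w - (1 + ε + t * I : ℂ))
        have he : (w - (1 + ε + t * I : ℂ)).re = w.re - (1 + ε) := by simp
        rw [he] at h
        exact lt_of_le_of_lt h hwball
      have him_lt : |w.im - t| < 3 * ε := by
        have h := abs_im_le_norm (w - (1 + ε + t * I : ℂ))
        have he : (w - (1 + ε + t * I : ℂ)).im = w.im - t := by simp
        rw [he] at h
        exact lt_of_le_of_lt h hwball
      have hwre' : 1 - 2 / ell D < w.re := by
        have h1 := (abs_lt.mp hre_lt).1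
        have h2 : (2 : ℝ) / ell D = 2 * ε := by rw [hε]; ring
        rw [h2]; linarith
      have hwim : |w.im| < 2 * D := by
        have hD1 : (1 : ℝ) ≤ D := by exact_mod_cast le_trans (by norm_num) hD3
        have h3 : 3 * ε ≤ 3 / 8 := by linarith
        calc |w.im| = |t + (w.im - t)| := by ring_nf
          _ ≤ |t| + |w.im - t| := abs_add_le _ _
          _ < D + 3 * ε := by linarith [him_lt, htD]
          _ ≤ 2 * D := by linarith
      exact huniq w h0 hwre' hwim
    -- the explicit `B` and its bounds (as in the away theorem)
    set B : ℝ := ((D : ℝ) * (|t| + 3)) ^ (2 * ε) * (4 + Real.log D + Real.log (|t| + 3)) with hB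
    have hDR : (1 : ℝ) ≤ (D : ℝ) := by exact_mod_cast le_trans (by norm_num) hD3
    have hlogD : Real.log D = ell D := rfl
    have hlogt : Real.log (|t| + 3) ≤ ell D + 1.4 := by
      have h1 : |t| + 3 ≤ 4 * D := by nlinarith [htD, abs_nonneg t]
      calc Real.log (|t| + 3) ≤ Real.log (4 * D) :=
            Real.log_le_log (by positivity) h1
        _ = Real.log 4 + Real.log D := Real.log_mul (by norm_num) (by positivity)
        _ ≤ ell D + 1.4 := by rw [hlogD]; linarith [log_four_le]
    have hlogt0 : 0 ≤ Real.log (|t| + 3) :=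
      Real.log_nonneg (by linarith [abs_nonneg t])
    have hlogD0 : 0 ≤ Real.log D := Real.log_nonneg hDR
    have hbase : (1 : ℝ) ≤ (D : ℝ) * (|t| + 3) := by nlinarith [abs_nonneg t]
    have hB4 : 4 ≤ B := by
      rw [hB]
      have h1 : (1 : ℝ) ≤ ((D : ℝ) * (|t| + 3)) ^ (2 * ε) := by
        calc (1 : ℝ) = ((D : ℝ) * (|t| + 3)) ^ (0 : ℝ) := (Real.rpow_zero _).symm
          _ ≤ ((D : ℝ) * (|t| + 3)) ^ (2 * ε) :=
              Real.rpow_le_rpow_of_exponent_le hbase (by positivity)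
      nlinarith [hlogt0, hlogD0]
    have hB2000 : B ≤ 2000 * ell D := by
      rw [hB]
      have h1 : ((D : ℝ) * (|t| + 3)) ^ (2 * ε) ≤ 500 := by
        refine le_trans ?_ exp_six_le
        rw [Real.rpow_def_of_pos (by positivity)]
        apply Real.exp_le_exp.mpr
        have hlogbase : Real.log ((D : ℝ) * (|t| + 3)) ≤ 3 * ell D := by
          rw [Real.log_mul (by positivity) (by positivity), hlogD]
          linarith [hlogt, hL8]
        calc Real.log ((D : ℝ) * (|t| + 3)) * (2 * ε) ≤ 3 * ell D * (2 * ε) := by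
              apply mul_le_mul_of_nonneg_right hlogbase (by positivity)
          _ = 6 * (ε * ell D) := by ring
          _ = 6 := by rw [hεL]; ring
      have h2 : 4 + Real.log D + Real.log (|t| + 3) ≤ 4 * ell D := by
        rw [hlogD]; linarith [hlogt, hL8]
      have hpos2 : (0 : ℝ) ≤ 4 + Real.log D + Real.log (|t| + 3) := by linarith
      calc ((D : ℝ) * (|t| + 3)) ^ (2 * ε) * (4 + Real.log D + Real.log (|t| + 3))
          ≤ 500 * (4 * ell D) := mul_le_mul h1 h2 hpos2 (by norm_num)
        _ = 2000 * ell D := by ring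
    have hBub : ∀ w ∈ ball (1 + ε + t * I : ℂ) (3 * ε), ‖χ.LFunction w‖ ≤ B :=
      fun w hw => norm_LFunction_le_on_ball χ hχ1 hε0 hε8 hw
    -- the NEAR floor at the line point
    have hz : (1 - ε + t * I : ℂ) ∈ closedBall (1 + ε + t * I : ℂ) (12 / 5 * ε) := by
      rw [mem_closedBall, dist_eq_norm]
      have he : (1 - ε + t * I : ℂ) - (1 + ε + t * I : ℂ) = ((-(2 * ε) : ℝ) : ℂ) := by
        push_cast; ring
      rw [he, Complex.norm_real, Real.norm_eq_abs, abs_neg, abs_of_pos (by positivity)]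
      linarith
    have hfloor := norm_LFunction_ge_of_simple_zero χ hχ1 hε0 hε8 hcase.le hρ0 hρd hρ1 hρle
      huniq' hB4 hBub hz
    -- `‖(1−ε+it) − ρ̃‖ ≥ ε/2`
    have hdist : ε / 2 ≤ ‖(1 - ε + t * I : ℂ) - (ρt : ℂ)‖ := by
      have h := abs_re_le_norm ((1 - ε + t * I : ℂ) - (ρt : ℂ))
      have he : ((1 - ε + t * I : ℂ) - (ρt : ℂ)).re = 1 - ε - ρt := by simp
      rw [he] at h
      have h1 : ε / 2 ≤ ρt - (1 - ε) := by linarith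
      have h2 : ρt - (1 - ε) ≤ |1 - ε - ρt| := by
        rw [abs_sub_comm]
        exact le_trans (le_refl _) (le_abs_self _)
      linarith
    -- unwind: `c·(20B𝓛)¹²·6¹³·2 ≤ 𝓛²⁴` with `20B/ε = 20B𝓛`
    have hLz0 : 0 < ‖χ.LFunction (1 - ε + t * I : ℂ)‖ := by
      by_contra h
      have h0 : ‖χ.LFunction (1 - ε + t * I : ℂ)‖ = 0 := le_antisymm (not_lt.mp h) (norm_nonneg _)
      have hLeq : χ.LFunction (1 - ε + t * I : ℂ) = 0 := norm_eq_zero.mp h0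
      have hmem : (1 - ε + t * I : ℂ) ∈ ball (1 + ε + t * I : ℂ) (3 * ε) := by
        have := mem_closedBall.mp hz
        rw [mem_ball]
        calc dist (1 - ε + t * I : ℂ) (1 + ε + t * I : ℂ) ≤ 12 / 5 * ε := this
          _ < 3 * ε := by linarith
      have := huniq' _ hmem hLeq
      -- then `im` gives `t = 0` and `re` gives `1 − ε = ρ̃ ≥ 1 − ε/2`, contradiction
      have hre : (1 : ℝ) - ε = ρt := by
        have := congrArg Complex.re this
        simpa using this
      linarith
    have hB0 : (0 : ℝ) < B := by linarith
    have h20B : 20 * B / ε = 20 * B * ell D := by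
      rw [hε, div_eq_mul_inv, inv_inv]
    rw [h20B] at hfloor
    have hpow0 : (0 : ℝ) < (20 * B * ell D) ^ 12 := by positivity
    refine le_trans (min_le_right _ _) ?_
    refine le_of_mul_le_mul_right ?_ hpow0
    have key1 : (ε / 2) * (1 / 6 : ℝ) ^ 13 * ell D ^ 25 ≤
        (‖χ.LFunction (1 - ε + t * I : ℂ)‖ * ell D ^ 25) * (20 * B * ell D) ^ 12 := by
      calc (ε / 2) * (1 / 6 : ℝ) ^ 13 * ell D ^ 25
          ≤ ‖(1 - ε + t * I : ℂ) - (ρt : ℂ)‖ * (1 / 6 : ℝ) ^ 13 * ell D ^ 25 := by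
            apply mul_le_mul_of_nonneg_right
              (mul_le_mul_of_nonneg_right hdist (by positivity)) (by positivity)
        _ ≤ (‖χ.LFunction (1 - ε + t * I : ℂ)‖ * (20 * B * ell D) ^ 12) * ell D ^ 25 := by
            apply mul_le_mul_of_nonneg_right hfloor (by positivity)
        _ = (‖χ.LFunction (1 - ε + t * I : ℂ)‖ * ell D ^ 25) * (20 * B * ell D) ^ 12 := by
            ring
    refine le_trans ?_ key1
    -- numeral endgame: `K⁻¹·(20B𝓛)¹² ≤ (ε/2)(1/6)¹³𝓛²⁵ = 𝓛²⁴·(1/6)¹³/2`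
    have hεhalf : (ε / 2) * (1 / 6 : ℝ) ^ 13 * ell D ^ 25 =
        ell D ^ 24 * ((1 / 6 : ℝ) ^ 13 / 2) := by
      have h1 : ε * ell D ^ 25 = ell D ^ 24 := by
        calc ε * ell D ^ 25 = ell D ^ 24 * (ε * ell D) := by ring
          _ = ell D ^ 24 := by rw [hεL, mul_one]
      calc (ε / 2) * (1 / 6 : ℝ) ^ 13 * ell D ^ 25
          = (ε * ell D ^ 25) * ((1 / 6 : ℝ) ^ 13 / 2) := by ring
        _ = ell D ^ 24 * ((1 / 6 : ℝ) ^ 13 / 2) := by rw [h1]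
    rw [hεhalf]
    have hstep : (20 * B * ell D) ^ 12 ≤ (40000 : ℝ) ^ 12 * (ell D ^ 2) ^ 12 := by
      have h1 : 20 * B * ell D ≤ 40000 * ell D ^ 2 := by
        calc 20 * B * ell D ≤ 20 * (2000 * ell D) * ell D := by
              apply mul_le_mul_of_nonneg_right
                (mul_le_mul_of_nonneg_left hB2000 (by norm_num)) hL0.le
          _ = 40000 * ell D ^ 2 := by ring
      calc (20 * B * ell D) ^ 12 ≤ (40000 * ell D ^ 2) ^ 12 :=
            pow_le_pow_left₀ (by positivity) h1 12
        _ = (40000 : ℝ) ^ 12 * (ell D ^ 2) ^ 12 := by rw [mul_pow]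
    calc (2 ^ 9 * 6 ^ 13 * 2000 ^ 8 * 40000 ^ 12 * 2 : ℝ)⁻¹ * (20 * B * ell D) ^ 12
        ≤ (2 ^ 9 * 6 ^ 13 * 2000 ^ 8 * 40000 ^ 12 * 2 : ℝ)⁻¹ *
          ((40000 : ℝ) ^ 12 * (ell D ^ 2) ^ 12) := by
          apply mul_le_mul_of_nonneg_left hstep (by positivity)
      _ = ((2 ^ 9 * 6 ^ 13 * 2000 ^ 8 * 40000 ^ 12 * 2 : ℝ)⁻¹ * (40000 : ℝ) ^ 12) *
          ell D ^ 24 := by ring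
      _ ≤ ((1 / 6 : ℝ) ^ 13 / 2) * ell D ^ 24 := by
          apply mul_le_mul_of_nonneg_right ?_ (by positivity)
          norm_num
      _ = ell D ^ 24 * ((1 / 6 : ℝ) ^ 13 / 2) := by ring

end Literature.NumberTheory.LFunctions.Zhang2022.Section8Floor
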